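import Literature.Topology.FourManifolds.TrisectionFunctorGKVanKampen
import Literature.Topology.FourManifolds.WeaklyReducibleTrisections
import Literature.AlgebraicTopology.FundamentalGroup.CircleValuedWindingCrossing
import Literature.AlgebraicTopology.FundamentalGroup.CircleValuedWindingPerturbation
import HarnessLib

/-!
# A character of `π₁(F)` vanishing on the three handlebody kernels detects `π₁(X)`

Topic `Literature/Topology/FourManifolds`; a small proved complement to (T4) of
`TrisectionFunctorGKVanKampen.lean` (`IsGKTrisection.surjective_inclHom_iInter_and_ker_eq`: for
a Gay–Kirby trisection `S` of `X` and a base point `x` of the central surface `F = ⋂ l, S l`,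
`π₁(F, x) → π₁(X, x)` is onto with kernel `⟪K₀ ∪ K₁ ∪ K₂⟫`, `K_q = ker (π₁ F → π₁ H_q)`,
`H_q = S (q+1) ∩ S (q+2)` the handlebody opposite to the sector `S q`), written by the fact seat of
`Literature.Topology.FourManifolds.Trisection.isConnectedSum_circleProd_of_reducing_nonseparating`
(`ReducibleTrisectionSplitting.lean`; Aranda–Zupan 2025, §2 p. 6: a trisection with a
NON-SEPARATING reducing curve splits off `S¹ × S³`, `X = X′ # (S¹ × S³)` — "a standard
argument").

## What is proved (everything; no definitions, no named facts)

* `IsGKTrisection.exists_hom_comp_inclHom_iInter_eq` — **a homomorphism `w : π₁(F, x) → G`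
  which vanishes on the three kernels `K₀, K₁, K₂` factors (uniquely) through
  `π₁(F, x) ↠ π₁(X, x)`**: by (T4) the kernel of the surjection `π₁(F) → π₁(X)` is the normal
  closure of `K₀ ∪ K₁ ∪ K₂`, which lies in the normal subgroup `ker w`
  (Abrams–Gay–Kirby 2018, p. 1540: `π₁(X)` is the colimit of the cube of the group trisection,
  so homomorphisms out of `π₁(X)` are exactly the homomorphisms out of `π₁(Σ)` killing the three
  kernels; Hatcher 2002, Thm. 1.20).
* `IsGKTrisection.nontrivial_fundamentalGroup_of_hom`,
  `IsGKTrisection.not_simplyConnectedSpace_of_hom` — **hence a non-trivial such `w` forces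
  `π₁(X, x) ≠ 1`**, i.e. `X` is not simply connected.
* `IsGKTrisection.not_simplyConnectedSpace_of_hom_spineHandlebody` — the same with the kernels
  indexed by `Trisection.spineHandlebody S q = ⋂ (l ≠ q), S l` (`WeaklyReducibleTrisections.lean`,
  `Trisection.spineHandlebody_eq_inter`), the vocabulary of `ReducibleTrisectionSplitting.lean`.
* `map_comp_inclHomOfSubset`, `ker_inclHomOfSubset_le_ker_of_extends`,
  `ker_inclHomOfSubset_le_ker_windingHom` — **supplying the kernel hypothesis**: a character
  of `π₁(F)` induced by a map `F → Z` which extends continuously over `H_q ⊇ F` vanishes on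
  `K_q` (functoriality).
* `IsGKTrisection.not_simplyConnectedSpace_of_circleMaps` — **the assembly**: a continuous
  `c : F → ℝ/ℤ` with continuous extensions `Θ_q : H_q → ℝ/ℤ` (`q = 0, 1, 2`) and a loop in `F`
  crossing the fibre `c⁻¹(0)` once (sign-changing local real lift;
  `CircleValuedWindingCrossing.lean`) force `¬ SimplyConnectedSpace X`.  What remains for the
  `π₁`-shadow of the Aranda–Zupan splitting is only the construction of these collapse maps
  from the reducing curve and its three compressing discs.
* `IsGKTrisection.not_simplyConnectedSpace_of_circleMaps_perturbed` — **the assembly with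
  perturbed restrictions**: it is enough that each `Θ_q` restricts on `F` to `± c + [D_q]` for a
  continuous REAL function `D_q` (`CircleValuedWindingPerturbation.lean`: such maps have winding
  homomorphisms with the same kernel as `c`).  This is the form produced by three collapse maps
  `circleCollapse K_q ρ` of the three compressing discs with one cut-off `ρ`: their traces on `F`
  have the common zero set `δ` but different normal coordinates `K_q|F`, equally or oppositely
  signed off `δ` (`ker_windingHom_circleCollapse_eq`, `…_of_neg`).

## Why (the intended use)

The only consumer of the Aranda–Zupan splitting fact in the tree
(`Summits/SmoothPoincare4/SmoothPoincare4/Theorems/WeakReductionDescentReducibleSplits.lean`)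
uses `X = X′ # (S¹ × S³)` solely to conclude that `X` is NOT simply connected.  That conclusion
is the `π₁`-shadow of the splitting and follows from the theorems of this file once a character
`w : π₁(F, x) → ℤ` is exhibited that (i) vanishes on each `K_q` and (ii) is non-zero — the
algebraic intersection number with the reducing curve `δ`: (i) because `δ` bounds a disc in every
`H_q` (the collapse map of `δ` in `F` extends over `H_q` as the collapse map of the disc, so its
winding homomorphism factors through `π₁(H_q)`), (ii) because `δ` is non-separating (a dual loop
in `F` crosses `δ` once, winding number `±1`; `CircleValuedWinding.lean`,
`NormalCoordinateCollapse.lean`).  Those two geometric inputs are NOT proved here; this file is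
the assembly step only, and it does not restate or weaken the named fact.

## References

* A. Abrams, D. Gay, R. Kirby, *Group trisections and smooth 4-manifolds*, Geom. Topol. 22
  (2018) 1537–1545, Def. 1 (p. 1538) and the map `𝒢` (p. 1540). [AbramsGayKirby2018]
* R. Aranda, A. Zupan, *Manifolds with weakly reducible genus-three trisections are standard*,
  arXiv:2503.04607 (2025), §2 p. 6 (reducing curves, non-separating case). [ArandaZupan2025]
* A. Hatcher, *Algebraic Topology*, CUP (2002), Thm. 1.20 (van Kampen), Prop. 1.26.
  [HatcherAT2002]
-/

noncomputable section

open Set Function Topology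
open scoped Manifold ContDiff

namespace Literature.Topology.FourManifolds

open Literature.AlgebraicTopology Literature.AlgebraicTopology.FundamentalGroup
  Literature.AlgebraicTopology.FundamentalGroup.VanKampen

universe u

variable {X : Type u} [TopologicalSpace X] [T2Space X] [SecondCountableTopology X]
  [ChartedSpace (EuclideanSpace ℝ (Fin 4)) X] {g : ℕ} {k : Fin 3 → ℕ} {S : Fin 3 → Set X}

/-- **A homomorphism out of `π₁(F)` vanishing on the three handlebody kernels factors through
`π₁(X)`.**  Let `S` be a Gay–Kirby trisection of `X`, `x` a point of the central surface
`F = ⋂ l, S l`, and `w : π₁(F, x) →* G` a homomorphism whose kernel contains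
`K_q = ker (π₁(F, x) → π₁(S (q+1) ∩ S (q+2), x))` for `q = 0, 1, 2`.  Then there is a (unique,
since `π₁(F) → π₁(X)` is onto) homomorphism `w′ : π₁(X, x) →* G` with `w′ ∘ incl⁎ = w`: by (T4)
the kernel of `incl⁎` is the normal closure of `K₀ ∪ K₁ ∪ K₂`, contained in the normal subgroup
`ker w` (Abrams–Gay–Kirby: `π₁(X)` is the colimit of the group-trisection cube).
[cite: AbramsGayKirby2018, p. 1540 (the map 𝒢) and Def. 1 (p. 1538)] -/
theorem IsGKTrisection.exists_hom_comp_inclHom_iInter_eq (h : IsGKTrisection X g k S) {x : X}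
    (hx : x ∈ ⋂ m, S m) {G : Type*} [Group G]
    (w : FundamentalGroup ↥(⋂ m, S m) ⟨x, hx⟩ →* G)
    (hw : ∀ q : Fin 3, (inclHomOfSubset (iInter_subset_inter S q) x hx
      (iInter_subset_inter S q hx)).ker ≤ w.ker) :
    ∃ w' : FundamentalGroup X x →* G, w'.comp (inclHom (⋂ m, S m) x hx) = w := by
  obtain ⟨hsurj, hker⟩ := h.surjective_inclHom_iInter_and_ker_eq 0 hx
  have hle : (inclHom (⋂ m, S m) x hx).ker ≤ w.ker := by
    rw [hker]
    refine Subgroup.normalClosure_le_normal ?_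
    rintro z ((h0 | h1) | h2)
    exacts [hw 0 h0, hw (0 + 1) h1, hw (0 + 2) h2]
  refine ⟨MonoidHom.liftOfSurjective (inclHom (⋂ m, S m) x hx) hsurj ⟨w, hle⟩, ?_⟩
  exact MonoidHom.liftOfRightInverse_comp _ _ _ _

/-- **A non-trivial character of `π₁(F)` killing the three kernels makes `π₁(X)` non-trivial.**
With `S`, `x`, `w` as in `IsGKTrisection.exists_hom_comp_inclHom_iInter_eq`, if `w ≠ 1` then the
fundamental group `π₁(X, x)` is non-trivial (the factorisation `w = w′ ∘ incl⁎` of a non-trivial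
homomorphism has a non-trivial source). [cite: AbramsGayKirby2018, p. 1540 (the map 𝒢)] -/
theorem IsGKTrisection.nontrivial_fundamentalGroup_of_hom (h : IsGKTrisection X g k S) {x : X}
    (hx : x ∈ ⋂ m, S m) {G : Type*} [Group G]
    (w : FundamentalGroup ↥(⋂ m, S m) ⟨x, hx⟩ →* G)
    (hw : ∀ q : Fin 3, (inclHomOfSubset (iInter_subset_inter S q) x hx
      (iInter_subset_inter S q hx)).ker ≤ w.ker)
    (hne : w ≠ 1) : Nontrivial (FundamentalGroup X x) := by
  obtain ⟨w', hw'⟩ := h.exists_hom_comp_inclHom_iInter_eq hx w hw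
  by_contra hnt
  haveI : Subsingleton (FundamentalGroup X x) := not_nontrivial_iff_subsingleton.1 hnt
  apply hne
  ext a
  rw [← hw', MonoidHom.comp_apply, Subsingleton.elim (inclHom (⋂ m, S m) x hx a) 1, map_one,
    MonoidHom.one_apply]

/-- **A non-trivial character of `π₁(F)` killing the three kernels obstructs simple
connectivity.**  With `S`, `x`, `w` as above and `w ≠ 1`, `X` is not simply connected (a simply
connected space has trivial fundamental groups).  This is the form in which the `π₁`-shadow of
Aranda–Zupan's splitting `X = X′ # (S¹ × S³)` of a trisection with a non-separating reducing
curve is consumed (the character being the intersection number with the reducing curve).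
[cite: AbramsGayKirby2018, p. 1540 (the map 𝒢)] -/
theorem IsGKTrisection.not_simplyConnectedSpace_of_hom (h : IsGKTrisection X g k S) {x : X}
    (hx : x ∈ ⋂ m, S m) {G : Type*} [Group G]
    (w : FundamentalGroup ↥(⋂ m, S m) ⟨x, hx⟩ →* G)
    (hw : ∀ q : Fin 3, (inclHomOfSubset (iInter_subset_inter S q) x hx
      (iInter_subset_inter S q hx)).ker ≤ w.ker)
    (hne : w ≠ 1) : ¬ SimplyConnectedSpace X := by
  intro hsc
  haveI := h.nontrivial_fundamentalGroup_of_hom hx w hw hne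
  exact false_of_nontrivial_of_subsingleton (FundamentalGroup X x)

omit [TopologicalSpace X] [T2Space X] [SecondCountableTopology X]
  [ChartedSpace (EuclideanSpace ℝ (Fin 4)) X] in
/-- The central surface lies in every handlebody of the spine (set-level, for the statement
below). [folklore] -/
theorem iInter_subset_spineHandlebody (S : Fin 3 → Set X) (q : Fin 3) :
    (⋂ m, S m) ⊆ Trisection.spineHandlebody S q :=
  Trisection.centralSurfaceSet_subset_spineHandlebody S q

/-- **The obstruction in the vocabulary of `ReducibleTrisectionSplitting.lean`.**  Same
statement as `IsGKTrisection.not_simplyConnectedSpace_of_hom`, with the three kernels taken in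
the handlebodies `Trisection.spineHandlebody S q = ⋂ (l ≠ q), S l` of
`WeaklyReducibleTrisections.lean` (equal to `S (q+1) ∩ S (q+2)`,
`Trisection.spineHandlebody_eq_inter`). [cite: AbramsGayKirby2018, p. 1540 (the map 𝒢)] -/
theorem IsGKTrisection.not_simplyConnectedSpace_of_hom_spineHandlebody
    (h : IsGKTrisection X g k S) {x : X} (hx : x ∈ ⋂ m, S m) {G : Type*} [Group G]
    (w : FundamentalGroup ↥(⋂ m, S m) ⟨x, hx⟩ →* G)
    (hw : ∀ q : Fin 3, (inclHomOfSubset (iInter_subset_spineHandlebody S q) x hx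
      (iInter_subset_spineHandlebody S q hx)).ker ≤ w.ker)
    (hne : w ≠ 1) : ¬ SimplyConnectedSpace X := by
  refine h.not_simplyConnectedSpace_of_hom hx w (fun q => ?_) hne
  rw [← ker_inclHomOfSubset_congr (Trisection.spineHandlebody_eq_inter S q)
    (iInter_subset_spineHandlebody S q) (iInter_subset_inter S q) hx]
  exact hw q

/-! ### Supplying the kernel hypothesis: characters that extend over the handlebodies -/

section Extend

variable {Y : Type*} [TopologicalSpace Y] {Z : Type*} [TopologicalSpace Z]

omit [TopologicalSpace X] [T2Space X] [SecondCountableTopology X]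
  [ChartedSpace (EuclideanSpace ℝ (Fin 4)) X] in
/-- **Functoriality: restricting a map to a smaller subspace.**  For subsets `A ⊆ B` of `Y`, a
continuous `Θ : B → Z` and a base point `x ∈ A`, the homomorphism induced by the restriction
`Θ ∘ incl : A → Z` is `Θ⁎ ∘ (A ⊆ B)⁎`. [folklore] -/
theorem map_comp_inclHomOfSubset {A B : Set Y} (hAB : A ⊆ B) {x : Y} (hA : x ∈ A)
    (hB : x ∈ B) (Θ : C(↥B, Z)) :
    (FundamentalGroup.map Θ ⟨x, hB⟩).comp (inclHomOfSubset hAB x hA hB) =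
      FundamentalGroup.map (Θ.comp (ContinuousMap.inclusion hAB)) ⟨x, hA⟩ := by
  ext a
  induction a using PushoutData.ind_fromPath with
  | h δ =>
    rw [MonoidHom.comp_apply]
    simp only [inclHomOfSubset, _root_.FundamentalGroup.mapOfEq_apply]
    rfl

omit [TopologicalSpace X] [T2Space X] [SecondCountableTopology X]
  [ChartedSpace (EuclideanSpace ℝ (Fin 4)) X] in
/-- **A character of `π₁(A)` which extends over `B ⊇ A` vanishes on `ker (π₁ A → π₁ B)`.**
If `w = v ∘ (Θ|_A)⁎` for a continuous `Θ : B → Z` and any homomorphism `v` out of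
`π₁(Z, Θ x)`, then `ker ((A ⊆ B)⁎) ≤ ker w`.  (In the application `A = F` is the central
surface, `B = H_q` a handlebody of the spine, `Z = ℝ/ℤ`, `Θ` the collapse map of a compressing
disc bounded by the reducing curve — extending the collapse map of the curve in `F` — and `v`
the isomorphism `π₁(ℝ/ℤ) ≅ ℤ`.) [folklore] -/
theorem ker_inclHomOfSubset_le_ker_of_extends {A B : Set Y} (hAB : A ⊆ B) {x : Y} (hA : x ∈ A)
    (hB : x ∈ B) (Θ : C(↥B, Z)) {G : Type*} [Group G]
    (v : FundamentalGroup Z (Θ ⟨x, hB⟩) →* G) :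
    (inclHomOfSubset hAB x hA hB).ker ≤
      (v.comp (FundamentalGroup.map (Θ.comp (ContinuousMap.inclusion hAB)) ⟨x, hA⟩)).ker := by
  intro a ha
  rw [MonoidHom.mem_ker] at ha ⊢
  rw [← map_comp_inclHomOfSubset hAB hA hB Θ, MonoidHom.comp_apply, MonoidHom.comp_apply, ha,
    map_one, map_one]

end Extend

/-! ### The assembly: circle-valued maps on the handlebodies and a dual loop -/

section Assembly

open scoped unitInterval

variable {Y : Type*} [TopologicalSpace Y]

omit [TopologicalSpace X] [T2Space X] [SecondCountableTopology X]
  [ChartedSpace (EuclideanSpace ℝ (Fin 4)) X] in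
/-- The kernel hypothesis supplied by a circle-valued map on `B ⊇ A` whose restriction to `A`
is a GIVEN map `c` (the form used below: `c` fixed on the central surface, one extension per
handlebody): `ker ((A ⊆ B)⁎) ≤ ker (wind ∘ c⁎)`. [folklore] -/
theorem ker_inclHomOfSubset_le_ker_windingHom {A B : Set Y} (hAB : A ⊆ B) {x : Y} (hA : x ∈ A)
    (hB : x ∈ B) (Θ : C(↥B, AddCircle (1 : ℝ))) (c : C(↥A, AddCircle (1 : ℝ)))
    (hc : Θ.comp (ContinuousMap.inclusion hAB) = c) :
    (inclHomOfSubset hAB x hA hB).ker ≤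
      ((fundamentalGroupAddCircleEquiv one_ne_zero (c ⟨x, hA⟩)).toMonoidHom.comp
        (FundamentalGroup.map c ⟨x, hA⟩)).ker := by
  subst hc
  exact ker_inclHomOfSubset_le_ker_of_extends hAB hA hB Θ
    (fundamentalGroupAddCircleEquiv one_ne_zero (Θ ⟨x, hB⟩)).toMonoidHom

/-- **The `π₁`-obstruction, assembled from circle-valued maps.**  Let `S` be a Gay–Kirby
trisection of `X` with central surface `F = ⋂ l, S l` and handlebodies
`H_q = Trisection.spineHandlebody S q`, and let `x ∈ F`.  Suppose given
* a continuous `c : F → ℝ/ℤ` (in the application: the collapse map of a reducing curve `δ`);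
* for each `q`, a continuous `Θ_q : H_q → ℝ/ℤ` restricting to `c` on `F` (the collapse map of a
  compressing disc of `δ` in `H_q`);
* a loop `γ` in `F` at `x` meeting the fibre `c⁻¹(0)` at a single time `t₀`, near which
  `c ∘ γ` has a real lift `μ` vanishing at `t₀` with opposite strict signs on the two sides (a
  dual loop crossing `δ` once).
Then `X` is not simply connected: the winding character `wind ∘ c⁎ : π₁(F, x) → ℤ` vanishes on
the three kernels `K_q` (it extends over each `H_q`, `ker_inclHomOfSubset_le_ker_windingHom`)
and is non-zero on `[γ]` (`windingHom_ne_one_of_crossing`), so it descends to a non-trivial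
character of `π₁(X, x)` (`IsGKTrisection.not_simplyConnectedSpace_of_hom_spineHandlebody`, from
(T4)).  This is the `π₁`-shadow of the splitting `X = X′ # (S¹ × S³)` of a trisection with a
non-separating reducing curve (Aranda–Zupan 2025, §2 p. 6), reduced to the construction of the
collapse maps. [cite: AbramsGayKirby2018, p. 1540 (the map 𝒢)] [cite: HatcherAT2002, Thm. 1.7 (p. 29)] -/
theorem IsGKTrisection.not_simplyConnectedSpace_of_circleMaps (h : IsGKTrisection X g k S)
    {x : X} (hx : x ∈ ⋂ m, S m) (c : C(↥(⋂ m, S m), AddCircle (1 : ℝ)))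
    (Θ : ∀ q : Fin 3, C(↥(Trisection.spineHandlebody S q), AddCircle (1 : ℝ)))
    (hΘ : ∀ q, (Θ q).comp (ContinuousMap.inclusion (iInter_subset_spineHandlebody S q)) = c)
    (γ : Path (⟨x, hx⟩ : ↥(⋂ m, S m)) ⟨x, hx⟩) (t₀ : I) (honly : ∀ t, c (γ t) = 0 → t = t₀)
    {U : Set I} (hU : U ∈ 𝓝 t₀) {μ : I → ℝ} (hμ : ContinuousOn μ U)
    (hμlift : ∀ t ∈ U, ((μ t : ℝ) : AddCircle (1 : ℝ)) = c (γ t)) (hμ0 : μ t₀ = 0)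
    (hsides : (∀ t ∈ U, t₀ < t → 0 < μ t) ∧ (∀ t ∈ U, t < t₀ → μ t < 0) ∨
      (∀ t ∈ U, t₀ < t → μ t < 0) ∧ (∀ t ∈ U, t < t₀ → 0 < μ t)) :
    ¬ SimplyConnectedSpace X := by
  refine h.not_simplyConnectedSpace_of_hom_spineHandlebody hx
    ((fundamentalGroupAddCircleEquiv one_ne_zero (c ⟨x, hx⟩)).toMonoidHom.comp
      (FundamentalGroup.map c ⟨x, hx⟩)) (fun q => ?_) ?_
  · exact ker_inclHomOfSubset_le_ker_windingHom (iInter_subset_spineHandlebody S q) hx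
      (iInter_subset_spineHandlebody S q hx) (Θ q) c (hΘ q)
  · exact (windingHom_ne_one_of_crossing c γ t₀ honly hU hμ hμlift hμ0 hsides).1

/-- **The assembly with perturbed restrictions.**  As in
`IsGKTrisection.not_simplyConnectedSpace_of_circleMaps`, but each `Θ_q : H_q → ℝ/ℤ` is only
required to restrict on the central surface `F` to `c + [D_q]` or to `-c + [D_q]` for some
continuous real function `D_q : F → ℝ` (instead of to `c` itself): the winding homomorphism of
such a restriction has the same kernel as that of `c` (`ker_windingHom_eq_of_eq_add_coe`,
`ker_windingHom_eq_of_eq_neg_add_coe` — a lift of `c ∘ γ` plus `D_q ∘ γ` lifts the perturbed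
map with the same increment), so the character `wind ∘ c⁎` still vanishes on the three kernels
`K_q`, and it is non-zero on the dual loop.  (Intended use: `c` and the `Θ_q` are collapse maps
`circleCollapse K_q ρ` of the three compressing discs of a non-separating reducing curve `δ` with
ONE cut-off `ρ`; their traces on `F` all vanish exactly on `δ` but come from different normal
coordinates, equally or oppositely signed off `δ`, and then differ from `± c` by the projection
of a continuous real function, `continuous_collapseDiff`.)
[cite: AbramsGayKirby2018, p. 1540 (the map 𝒢)] [cite: HatcherAT2002, Thm. 1.7 (p. 29)] -/
theorem IsGKTrisection.not_simplyConnectedSpace_of_circleMaps_perturbed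
    (h : IsGKTrisection X g k S) {x : X} (hx : x ∈ ⋂ m, S m)
    (c : C(↥(⋂ m, S m), AddCircle (1 : ℝ)))
    (Θ : ∀ q : Fin 3, C(↥(Trisection.spineHandlebody S q), AddCircle (1 : ℝ)))
    (D : Fin 3 → ↥(⋂ m, S m) → ℝ) (hD : ∀ q, Continuous (D q))
    (hΘ : ∀ q, (∀ y, Θ q (ContinuousMap.inclusion (iInter_subset_spineHandlebody S q) y) =
        c y + ((D q y : ℝ) : AddCircle (1 : ℝ))) ∨
      (∀ y, Θ q (ContinuousMap.inclusion (iInter_subset_spineHandlebody S q) y) =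
        -c y + ((D q y : ℝ) : AddCircle (1 : ℝ))))
    (γ : Path (⟨x, hx⟩ : ↥(⋂ m, S m)) ⟨x, hx⟩) (t₀ : I) (honly : ∀ t, c (γ t) = 0 → t = t₀)
    {U : Set I} (hU : U ∈ 𝓝 t₀) {μ : I → ℝ} (hμ : ContinuousOn μ U)
    (hμlift : ∀ t ∈ U, ((μ t : ℝ) : AddCircle (1 : ℝ)) = c (γ t)) (hμ0 : μ t₀ = 0)
    (hsides : (∀ t ∈ U, t₀ < t → 0 < μ t) ∧ (∀ t ∈ U, t < t₀ → μ t < 0) ∨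
      (∀ t ∈ U, t₀ < t → μ t < 0) ∧ (∀ t ∈ U, t < t₀ → 0 < μ t)) :
    ¬ SimplyConnectedSpace X := by
  refine h.not_simplyConnectedSpace_of_hom_spineHandlebody hx
    ((fundamentalGroupAddCircleEquiv one_ne_zero (c ⟨x, hx⟩)).toMonoidHom.comp
      (FundamentalGroup.map c ⟨x, hx⟩)) (fun q => ?_) ?_
  · -- the trace of `Θ_q` on `F` and its winding homomorphism
    set cq : C(↥(⋂ m, S m), AddCircle (1 : ℝ)) :=
      (Θ q).comp (ContinuousMap.inclusion (iInter_subset_spineHandlebody S q)) with hcq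
    have hker := ker_inclHomOfSubset_le_ker_windingHom (iInter_subset_spineHandlebody S q) hx
      (iInter_subset_spineHandlebody S q hx) (Θ q) cq rfl
    have heq : ((fundamentalGroupAddCircleEquiv one_ne_zero (cq ⟨x, hx⟩)).toMonoidHom.comp
        (FundamentalGroup.map cq ⟨x, hx⟩)).ker =
        ((fundamentalGroupAddCircleEquiv one_ne_zero (c ⟨x, hx⟩)).toMonoidHom.comp
          (FundamentalGroup.map c ⟨x, hx⟩)).ker := by
      rcases hΘ q with hq | hq
      · exact ker_windingHom_eq_of_eq_add_coe cq c (hD q) (fun y => hq y) ⟨x, hx⟩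
      · exact ker_windingHom_eq_of_eq_neg_add_coe cq c (hD q) (fun y => hq y) ⟨x, hx⟩
    rw [← heq]
    exact hker
  · exact (windingHom_ne_one_of_crossing c γ t₀ honly hU hμ hμlift hμ0 hsides).1

end Assembly

end Literature.Topology.FourManifolds

end
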